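import Summits.BirchSwinnertonDyer.BirchSwinnertonDyer.Theorems.AdditiveKolyvaginRoadLevelSystemsTransferSocket
import Summits.BirchSwinnertonDyer.BirchSwinnertonDyer.Theorems.AdditiveKolyvaginRoadLevelKolyvaginSystemsAdditiveStubTorsionIsoBaseChange
import Summits.BirchSwinnertonDyer.BirchSwinnertonDyer.Theorems.AdditiveKolyvaginRoadBottomTransferKrizLiDepletion
import Summits.BirchSwinnertonDyer.BirchSwinnertonDyer.Theorems.AdditiveKolyvaginRoadLevelKolyvaginSystemsAdditiveStubTamagawaOffP
import Literature.NumberTheory.EllipticCurves.KrausOesterle1992.TraceCongruenceOfTorsionIsoProofs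
import HarnessLib

/-!
# Route `AdditiveKolyvaginRoad`, crux KS′ `LevelKolyvaginSystemsAdditive` (item stmt-BirchSwinnertonDyer-21396):
# the (γ)-LOCUS ASSEMBLY of line `epsilon_matched_retyping` — the fibre of KS′ at an avatar frame from the LENDER's level system,
# the two local bridge statements and ONE numerical certificate, through Kriz–Li Thm. 1.16
# (cell `pub/bsd-wall`, width seat `bsd-wall-akr-p2x-w3` g4; `--supports stmt-BirchSwinnertonDyer-21396`, helper)

WHY. The line's skeleton composes the crux on its avatar locus from seven stubs through this seat's socket v3
(`nonempty_levelKolyvaginSystemP_of_torsionCongr_tamagawa`). Two of its E-side stubs are now tree theorems — θ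
(`stub_torsionIsoBaseChange`, p602788) and, on the sub-row (γ), the OPEN glue (A2) `stub_bottomTransfer`
(`exists_kolyvaginClass_ne_zero_of_thm116_of_sign`, p604313 ∕ p605382 ∕ p605510: Kriz–Li's logarithm congruence, GZ-free, modulo a
per-frame certificate «the avatar's Heegner point is not `p`-divisible in `E₀(ℚ_p)`»). THIS FILE re-runs the skeleton's composition at
ONE avatar frame of the (γ)-locus with those two stubs PLUGGED, so that what the fibre of KS′ still needs there is displayed as exactly
three hypotheses: the lender's level system `S₀` (stub S₀, W. Zhang 2014 verbatim for the good-ordinary `E₀`), and the two LOCAL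
statements over the completions of `K` — (Tam) at the bad places prime to `p` and (θK)ₚ above `p` (stubs (Tam), S4; width seat w2's
split-completion bridge) — plus the certificate and Kriz–Li Thm. 1.16 BY NAME.

* `nonempty_levelKolyvaginSystemP_on_gammaLocus` — **KS′-fibre at a (γ)-avatar frame**: `Nonempty (LevelKolyvaginSystemP W K p Dt β ι c)`
  from `hKL` ∧ frame ∧ avatar locus (with SIGN AGREEMENT at the multiplicative primes) ∧ `S₀` ∧ (Tam) ∧ (θK)ₚ ∧ certificate. The trace
  congruence off `pN` is Kraus–Oesterlé (PROVED), exactly as in the skeleton.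

HONEST FRAMING: one theorem; 0 definitions, 0 named facts, 0 `sorry`; CONDITIONAL on `hKL`, `S₀`, (Tam), (θK)ₚ and the certificate
(all hypotheses, spelled inline). Closes nothing: KS′ quantifies over ALL ♯ frames; this is its fibre on a sub-locus. BSD is NOT proved
by any of this.

References: [cite: KrizLi2019, Thm. 1.16, Rem. 1.17] [cite: KrausOesterle1992, §3 Prop. 3] [cite: WZhang2014, Thm. 4.3, Thm. 7.2, §9]
[cite: GrossLMS1991, §4 (4.4)].
-/

set_option linter.dupNamespace false -- single-conjunct summit repeats the name by design

noncomputable section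

open scoped Classical

namespace Summit.BirchSwinnertonDyer.BirchSwinnertonDyer.Theorems.AdditiveKoly

open WeierstrassCurve NumberField IsDedekindDomain Field
  Literature.NumberTheory.EllipticCurves Literature.NumberTheory.EllipticCurves.ModularForms
  Literature.NumberTheory.EllipticCurves.Rank1Residual Literature.NumberTheory.GaloisRepresentations
  Literature.NumberTheory.GaloisCohomology Module Summit.BirchSwinnertonDyer.Rank1Residual

variable (W W₀ : WeierstrassCurve ℚ) (K : Type) [Field K] [NumberField K] (p : ℕ)
  [W.IsGloballyMinimal] [W₀.IsGloballyMinimal] (c : K ≃ₐ[ℚ] K)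
  [Module (ZMod p) (Vp W K p)] [Module (ZMod p) (Vp W₀ K p)]
  [W.IsElliptic] [W₀.IsElliptic] [hp : Fact p.Prime] [NeZero (W.conductorNorm ℤ)] [NeZero (W₀.conductorNorm ℤ)]

/-- **THE FIBRE OF KS′ AT A (γ)-AVATAR FRAME.** Frame: `E = W` globally minimal, ADDITIVE at `p ≥ 5`, `ρ̄_{E,p}` onto, `K` imaginary
quadratic with `d_K < −4` and the Heegner hypothesis for `N_E`, `4N_E ∣ β² − d_K`, `p ∤ c(Dt)`, a complex conjugation `c`. Avatar
`E₀ = W₀`: globally minimal, `Γ_ℚ`-equivariant `e : E[p] ≃ E₀[p]`, GOOD NON-ANOMALOUS at `p`, `hrad`, `htype`, sign agreement `hsign`,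
Heegner hypothesis for `N₀`, `p ∤ c(Dt₀)` (`p` splits in `K` automatically: `p ∣ N_E`). INPUTS: Kriz–Li Thm. 1.16 BY NAME (`hKL`); the LENDER's level Kolyvagin system `S₀`
(stub S₀); (Tam) at the bad places `v ∤ p`; (θK)ₚ for every `Γ_K`-equivariant `θ` at the places above `p` (stub S4's shape); the
CERTIFICATE «some Heegner point `y₀ ∈ E₀(K)` over `heegnerPointComplex Dt₀ H₀` is not `p`-divisible in `E₀(ℚ_p)` along `ιp`».
CONCLUSION: `LevelKolyvaginSystemP W K p Dt β ι c` is inhabited. Proof = the skeleton's composition with θ and (A2)|(γ) plugged: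
`stub_torsionIsoBaseChange` at `τ = liftAut c`, Kraus–Oesterlé off `pN`, `exists_kolyvaginClass_ne_zero_of_thm116_of_sign`, socket v3.
[cite: KrizLi2019, Thm. 1.16] [cite: KrausOesterle1992, §3 Prop. 3 (i) ⇒ (iii)] [cite: WZhang2014, Thm. 4.3, §9] -/
theorem nonempty_levelKolyvaginSystemP_on_gammaLocus (hKL : KrizLi2019.thm116_padicLogHeegner_congruence)
    (Dt : ModularParametrizationData W (W.conductorNorm ℤ)) (β : ℤ) (ι : K →+* ℂ)
    (hp5 : 5 ≤ p) (hadd : Addv W p) (hs : W.HasSurjectiveModNGaloisRep p)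
    (hK : IsImaginaryQuadratic K) (hlt : NumberField.discr K < -4) (hH : SatisfiesHeegnerHypothesis (W.conductorNorm ℤ) K)
    (hβ : (4 * (W.conductorNorm ℤ : ℤ)) ∣ β ^ 2 - NumberField.discr K) (hc : ¬ (p : ℤ) ∣ Dt.c)
    (e : geomTorsion W (p : ℤ) ≃+ geomTorsion W₀ (p : ℤ))
    (he : ∀ (σ : absoluteGaloisGroup ℚ) (T : geomTorsion W (p : ℤ)), e (σ • T) = σ • e T)
    (hgood₀ : W₀.HasGoodReductionAtPrime p) (hna : ¬ (p : ℤ) ∣ W₀.frobeniusTrace p - 1)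
    (hrad : ∀ q : ℕ, q.Prime → (q ∣ p * W.conductorNorm ℤ ↔ q ∣ p * W₀.conductorNorm ℤ))
    (htype : ∀ (ℓ : ℕ) [Fact ℓ.Prime], W.HasMultiplicativeReductionAtPrime ℓ ↔ W₀.HasMultiplicativeReductionAtPrime ℓ)
    (hsign : ∀ (ℓ : ℕ) [Fact ℓ.Prime], W₀.HasMultiplicativeReductionAtPrime ℓ → W.LFunction ℓ = W₀.LFunction ℓ)
    (Dt₀ : ModularParametrizationData W₀ (W₀.conductorNorm ℤ)) (β₀ : ℤ) (hc₀ : ¬ (p : ℤ) ∣ Dt₀.c)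
    (hH₀ : SatisfiesHeegnerHypothesis (W₀.conductorNorm ℤ) K) (ιp : K →+* ℚ_[p])
    (S₀ : LevelKolyvaginSystemP W₀ K p Dt₀ β₀ ι c)
    (hTam : ∀ v : HeightOneSpectrum (𝓞 K), (p : 𝓞 K) ∉ v.asIdeal →
      ¬ ((W.baseChange K).HasGoodReductionAt v ∧ (W₀.baseChange K).HasGoodReductionAt v) →
      ¬ p ∣ ((W.baseChange K).baseChange (v.adicCompletion K)).localTamagawaNumber (v.adicCompletionIntegers K) ∧
      ¬ p ∣ ((W₀.baseChange K).baseChange (v.adicCompletion K)).localTamagawaNumber (v.adicCompletionIntegers K))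
    (hKumP : ∀ (θ : geomTorsion (W₀.baseChange K) ((p ^ 1 : ℕ) : ℤ) ≃+ geomTorsion (W.baseChange K) ((p ^ 1 : ℕ) : ℤ))
      (hθ : ∀ (g : absoluteGaloisGroup K) (P : geomTorsion (W₀.baseChange K) ((p ^ 1 : ℕ) : ℤ)), θ (g • P) = g • θ P),
      ∀ v : HeightOneSpectrum (𝓞 K), (p : 𝓞 K) ∈ v.asIdeal →
      ∀ y : Vp W₀ K p, h1Equiv θ hθ y ∈ selmerLocalKer (W.baseChange K) (v.adicCompletion K) ((p ^ 1 : ℕ) : ℤ) ↔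
        y ∈ selmerLocalKer (W₀.baseChange K) (v.adicCompletion K) ((p ^ 1 : ℕ) : ℤ))
    (hcert : ∃ (H₀ : HeegnerDatum (W₀.conductorNorm ℤ) (NumberField.discr K)) (y₀ : (W₀.baseChange K).toAffine.Point),
      WeierstrassCurve.Affine.Point.map ι.toRatAlgHom y₀ = heegnerPointComplex Dt₀ H₀ ∧
        ¬ ∃ Q : (W₀.baseChange ℚ_[p]).toAffine.Point, (p : ℤ) • Q = X11b.padicPointOf W₀ p ιp y₀) :
    Nonempty (LevelKolyvaginSystemP W K p Dt β ι c) := by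
  -- `p` splits in `K`: `p ∣ N_E` (additive, hence bad, reduction) and `K` is Heegner for `N_E`
  have hsplit : ((Ideal.span {(p : ℤ)}).primesOver (𝓞 K)).ncard = 2 :=
    hH p hp.out ((W.dvd_conductorNorm_iff_not_hasGoodReductionAtPrime p).mpr hadd.1)
  -- θ over `K̄`, commuting with the lift `liftAut c` of `c` (stub θ, landed)
  obtain ⟨θ, hθ, hθτ⟩ := stub_torsionIsoBaseChange W W₀ p K c (isLiftOfAut_liftAut c) e he
  -- congruence of traces off `pN` (Kraus–Oesterlé Prop. 3 (i) ⇒ (iii), proved)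
  have ha : ∀ q : ℕ, q.Prime → ¬ q ∣ p * W.conductorNorm ℤ →
      (p : ℤ) ∣ W.frobeniusTrace q - W₀.frobeniusTrace q := by
    intro q hq hqn
    haveI : Fact q.Prime := ⟨hq⟩
    have hqp : q ≠ p := fun h ↦ hqn (h ▸ dvd_mul_right q _)
    have hW : W.HasGoodReductionAtPrime q :=
      hasGoodReductionAtPrime_of_not_dvd_conductorNorm W fun h ↦ hqn (dvd_mul_of_dvd_right h p)
    have hW₀ : W₀.HasGoodReductionAtPrime q :=
      hasGoodReductionAtPrime_of_not_dvd_conductorNorm W₀ fun h ↦ hqn ((hrad q hq).mpr (dvd_mul_of_dvd_right h p))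
    exact KrausOesterle1992.dvd_frobeniusTrace_sub_of_addEquiv_geomTorsion W W₀ p e he q hqp hW hW₀
  -- (A2) on the (γ) sub-row: the certificate gives `c_E(1) ≠ 0` outright (the lender's non-vanishing premise is not even used)
  have hA2 : (∃ (m₀ : Finset {ℓ // Zhang2014.IsKolyvaginPrime (W₀.conductorNorm ℤ) W₀ K p ℓ})
        (d₀ : KolyvaginHeegnerData Dt₀ β₀ ι (∏ ℓ ∈ m₀, (ℓ : ℕ))), d₀.kolyvaginClass (Fact.out : p.Prime) 1 ≠ 0) →
      ∃ (m : Finset {ℓ // Zhang2014.IsKolyvaginPrime (W.conductorNorm ℤ) W K p ℓ})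
        (d : KolyvaginHeegnerData Dt β ι (∏ ℓ ∈ m, (ℓ : ℕ))), d.kolyvaginClass (Fact.out : p.Prime) 1 ≠ 0 :=
    fun _ ↦ exists_kolyvaginClass_ne_zero_of_thm116_of_sign W p K Dt β ι hKL hp5 hadd hs hK hlt hH hβ hc W₀ e he hgood₀ hna
      hrad htype hsign Dt₀ hc₀ hH₀ hsplit ιp hcert
  exact nonempty_levelKolyvaginSystemP_of_torsionCongr_tamagawa W W₀ K p c Dt β ι Dt₀ β₀ hK hH hβ θ hθ
    (isLiftOfAut_liftAut c) hθτ hrad ha hTam (hKumP θ hθ) S₀ hA2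

/-- **THE FIBRE OF KS′ AT A (γ)-AVATAR FRAME, (Tam) DISCHARGED** (appended once `stub_tamagawaOffP` landed): the previous theorem with
the local hypothesis `hTam` replaced by the frame's `p ∤ ∏ c(E)` and the locus's `p ∤ ∏ c(E₀)` — (Tam) is now a tree theorem
(`stub_tamagawaOffP`: degree-one transport of local Tamagawa numbers at the split bad primes). What the fibre still needs on the
(γ)-locus: Kriz–Li Thm. 1.16 BY NAME, the lender's level system `S₀`, (θK)ₚ (`hKumP`, stub S4's shape) and the numerical certificate.
[cite: KrizLi2019, Thm. 1.16] [cite: SilvermanAEC2009, VII.6.1] [cite: Castella2018, §5] [cite: WZhang2014, Thm. 4.3, §9] -/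
theorem nonempty_levelKolyvaginSystemP_on_gammaLocus' (hKL : KrizLi2019.thm116_padicLogHeegner_congruence)
    (Dt : ModularParametrizationData W (W.conductorNorm ℤ)) (β : ℤ) (ι : K →+* ℂ)
    (hp5 : 5 ≤ p) (hadd : Addv W p) (hs : W.HasSurjectiveModNGaloisRep p)
    (hK : IsImaginaryQuadratic K) (hlt : NumberField.discr K < -4) (hH : SatisfiesHeegnerHypothesis (W.conductorNorm ℤ) K)
    (hβ : (4 * (W.conductorNorm ℤ : ℤ)) ∣ β ^ 2 - NumberField.discr K) (hc : ¬ (p : ℤ) ∣ Dt.c) (htam : ¬ p ∣ W.tamagawaProduct)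
    (e : geomTorsion W (p : ℤ) ≃+ geomTorsion W₀ (p : ℤ))
    (he : ∀ (σ : absoluteGaloisGroup ℚ) (T : geomTorsion W (p : ℤ)), e (σ • T) = σ • e T)
    (hgood₀ : W₀.HasGoodReductionAtPrime p) (hna : ¬ (p : ℤ) ∣ W₀.frobeniusTrace p - 1)
    (hrad : ∀ q : ℕ, q.Prime → (q ∣ p * W.conductorNorm ℤ ↔ q ∣ p * W₀.conductorNorm ℤ))
    (htype : ∀ (ℓ : ℕ) [Fact ℓ.Prime], W.HasMultiplicativeReductionAtPrime ℓ ↔ W₀.HasMultiplicativeReductionAtPrime ℓ)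
    (hsign : ∀ (ℓ : ℕ) [Fact ℓ.Prime], W₀.HasMultiplicativeReductionAtPrime ℓ → W.LFunction ℓ = W₀.LFunction ℓ)
    (Dt₀ : ModularParametrizationData W₀ (W₀.conductorNorm ℤ)) (β₀ : ℤ) (hc₀ : ¬ (p : ℤ) ∣ Dt₀.c)
    (hH₀ : SatisfiesHeegnerHypothesis (W₀.conductorNorm ℤ) K) (htam₀ : ¬ p ∣ W₀.tamagawaProduct) (ιp : K →+* ℚ_[p])
    (S₀ : LevelKolyvaginSystemP W₀ K p Dt₀ β₀ ι c)
    (hKumP : ∀ (θ : geomTorsion (W₀.baseChange K) ((p ^ 1 : ℕ) : ℤ) ≃+ geomTorsion (W.baseChange K) ((p ^ 1 : ℕ) : ℤ))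
      (hθ : ∀ (g : absoluteGaloisGroup K) (P : geomTorsion (W₀.baseChange K) ((p ^ 1 : ℕ) : ℤ)), θ (g • P) = g • θ P),
      ∀ v : HeightOneSpectrum (𝓞 K), (p : 𝓞 K) ∈ v.asIdeal →
      ∀ y : Vp W₀ K p, h1Equiv θ hθ y ∈ selmerLocalKer (W.baseChange K) (v.adicCompletion K) ((p ^ 1 : ℕ) : ℤ) ↔
        y ∈ selmerLocalKer (W₀.baseChange K) (v.adicCompletion K) ((p ^ 1 : ℕ) : ℤ))
    (hcert : ∃ (H₀ : HeegnerDatum (W₀.conductorNorm ℤ) (NumberField.discr K)) (y₀ : (W₀.baseChange K).toAffine.Point),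
      WeierstrassCurve.Affine.Point.map ι.toRatAlgHom y₀ = heegnerPointComplex Dt₀ H₀ ∧
        ¬ ∃ Q : (W₀.baseChange ℚ_[p]).toAffine.Point, (p : ℤ) • Q = X11b.padicPointOf W₀ p ιp y₀) :
    Nonempty (LevelKolyvaginSystemP W K p Dt β ι c) :=
  nonempty_levelKolyvaginSystemP_on_gammaLocus W W₀ K p c hKL Dt β ι hp5 hadd hs hK hlt hH hβ hc e he hgood₀ hna hrad htype hsign
    Dt₀ β₀ hc₀ hH₀ ιp S₀ (fun v hvp hv ↦ stub_tamagawaOffP W W₀ p K htam htam₀ hK hH hrad v hvp hv) hKumP hcert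


end Summit.BirchSwinnertonDyer.BirchSwinnertonDyer.Theorems.AdditiveKoly

end
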